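import Summits.BirchSwinnertonDyer.BirchSwinnertonDyer.Theorems.ByReductionTypeAtTwoSupersingularFlatCountTwoOfShaTwo
import Summits.BirchSwinnertonDyer.BirchSwinnertonDyer.Theorems.ByReductionTypeAtTwoSupersingularFlatLocalLiftHloc2
import Summits.BirchSwinnertonDyer.BirchSwinnertonDyer.Theorems.ThetaPartnerAtTwoSignedControlAtTwoCasselsOfPT
import HarnessLib

/-!
# COUNT♭@2 door v9 — from CASSELS and the three generic Poitou–Tate rows over `ℚ` ALONE (the `♭`-local lift at `2`
# is the tree theorem `hloc2_of_flatData`); NO Greenberg Prop. 4.12, NO Kato Thm. 12.4, no displayed local input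
# (item stmt-BirchSwinnertonDyer-19097 `SupersingularRankZeroAtTwo`, route `ByReductionTypeAtTwo`, line `flat_uniform_two`)

Seat `bsd-inputs-k4-p1` (ASIDE seat of the K4 Greenberg-1999 inputs; no claim).  THEOREMS ONLY (no definition, no named
fact, no `sorry`); CASSELS and the three Poitou–Tate rows over `ℚ` enter as HYPOTHESES BY NAME (conditional results).

Door v8 (`SSFlatEC.flatCountTwo_of_print3`, K4 width seat w3) displays three named facts {Prop. 4.13 (Cassels),
Prop. 4.12 `prop412_noFiniteSubmodule_H1Sigma_of_rank_one`, §5 p. 140 / Kato Thm. 12.4 `h1SigmaInfty_rank_eq_one`} and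
no local input.  Door `flatCountTwo_of_cassels_of_poitouTate_of_clauses` (`…FlatCountTwoOfShaTwo`, this seat) trades
Prop. 4.12 + Kato 12.4 for the three GENERIC class-field-theory rows {`poitouTate_sha_tateDual ℚ` (Milne I 4.10 (a)),
`poitouTate_three_realPlaces_injective ℚ` (4.10 (c), `r = 3`), `poitouTate_two_realPlaces_surjective ℚ` (Cor. 4.16)} but
still displays the `♭`-local lift `hloc2` at `2`; the bsd-2adic lane's `hloc2_of_flatData` (part 21, from the Honda₂
clauses; the unramified-outside-`S₀` binder it carries is supplied by AEU `SignedEC.ResTwo.exists_finset_mem_unramifiedOutside`)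
discharges it.  This file composes the two:

* `flatCountTwo_of_cassels_of_poitouTate_all` — **door v9**: `GoodSS W 2`, `κ` cyclotomic with topological generator,
  the Honda₂ clauses `hg hc hTr hinj hsat` of `stub_allFlatData`, and BY NAME {CASSELS, PT(a), 4.10(c)₃, 4.16}(ℚ) ⟹ the
  COUNT♭@2 clause verbatim.  Displayed residue: NONE.  Named facts: four, all outputs of the class-formation road
  (Cassels itself is `poitouTate_selmerStructure_duality ℚ` modulo the K4 width seat's `casselsSurjectivity_H1Sigma_of_poitouTate`);
* `flatCountTwo_of_cassels_of_shaTwo_all` — the same keyed on `Ш²(ℚ, E[2^∞]) = ⊥` instead of the three rows (for a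
  consumer that proves `Ш² = 0` another way);
* `flatCountTwo_of_poitouTate_all` — **door v10**: CASSELS itself supplied from PT(b) `poitouTate_selmerStructure_duality ℚ`
  by the K4 width seat's `SignedEC.CasselsPT.casselsSurjectivity_H1Sigma_of_poitouTate`; displayed named facts = EXACTLY
  the four generic Poitou–Tate rows over `ℚ` {PT(b), PT(a), 4.10(c)₃, 4.16} = the K4 (`SignedControlAtTwo`) residue of record.

HONEST TAG of COUNT♭@2 after this file: by-name {CASSELS, PT(a), 4.10(c)₃, 4.16}(ℚ) ∘ THEOREMS; nothing about any curve
is asserted unconditionally; the crux's ∀-form stays as the line has it; closes no item by itself; no summit statement is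
proved by this seat; BSD is not proved by any of this.

References: [GreenbergLNM1716] §4 Prop. 4.13 / p. 122, Lemma 4.7 (pp. 107–108), p. 104, Prop. 4.12 (p. 119);
[MilneADT2006] I Thm. 4.10 (a),(c), Cor. 4.16, Thm. 6.13 (c); [Sprung2012] §7 Def. 7.9–7.11, Lemma 2.3.
-/

set_option autoImplicit false
-- the Theorems namespace of this sub repeats the summit name by design (D-0017 nested layout)
set_option linter.dupNamespace false

noncomputable section

open scoped Classical NumberField

open NumberField IsDedekindDomain

namespace Summit.BirchSwinnertonDyer.BirchSwinnertonDyer.Theorems.SSFlatEC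

open Literature.NumberTheory.EllipticCurves Literature.NumberTheory.GaloisRepresentations
  WeierstrassCurve ZpExtension Literature.NumberTheory.EllipticCurves.Kobayashi2003
  Literature.NumberTheory.EllipticCurves.Sprung2017 Literature.NumberTheory.EllipticCurves.Sprung2012
  Literature.NumberTheory.EllipticCurves.Sprung2024 Literature.NumberTheory.EllipticCurves.IwasawaDual
  Literature.NumberTheory.EllipticCurves.IwasawaAlgebra Literature.NumberTheory.EllipticCurves.GreenbergVatsal2000
  Literature.NumberTheory.EllipticCurves.Rank1Residual Summit.BirchSwinnertonDyer.Rank1Residual.X5.O1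
  Literature.NumberTheory.GaloisCohomology
open Summit.BirchSwinnertonDyer.Rank1Residual.X11b (LocBridge.primaryGaloisModule)
open Literature.NumberTheory.GaloisRepresentations.DiscreteGaloisModule (shaTwo)

variable (W : WeierstrassCurve ℚ) [W.IsElliptic] [W.IsGloballyMinimal]

/-- **DOOR v9 — COUNT♭@2 from CASSELS and the three generic Poitou–Tate rows over `ℚ`, on the line's Honda₂ clauses;
no displayed input.**  `flatCountTwo_of_cassels_of_poitouTate_of_clauses` with its `♭`-local lift `hloc2` supplied by
`hloc2_of_flatData` (AEU gives the finite `S₀` outside which the class is unramified).  Named facts displayed: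
`casselsSurjectivity_H1Sigma ℚ`, `poitouTate_sha_tateDual ℚ`, `poitouTate_three_realPlaces_injective ℚ`,
`poitouTate_two_realPlaces_surjective ℚ` — no Prop. 4.12, no Kato Thm. 12.4, no corank count, no p. 108.
[cite: GreenbergLNM1716, §4 Prop. 4.13 / p. 122, Lemma 4.7 (pp. 107–108), Prop. 4.12 (p. 119)]
[cite: MilneADT2006, Ch. I, Thm. 4.10 (a),(c), Cor. 4.16, Thm. 6.13 (c)] [cite: Sprung2012, §7 Def. 7.9, Lemma 7.10] -/
theorem flatCountTwo_of_cassels_of_poitouTate_all (hss : GoodSS W 2) (κ : ZpExtension ℚ 2) (hκ : κ.IsCyclotomic)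
    {γ : Field.absoluteGaloisGroup ℚ} (hγ : κ.IsTopGenerator γ) {v : HeightOneSpectrum (𝓞 ℚ)}
    (hv : (2 : 𝓞 ℚ) ∈ v.asIdeal)
    {g : Field.absoluteGaloisGroup (v.adicCompletion ℚ)} {c : ℕ → localPoints W (v.adicCompletion ℚ)}
    -- the Honda₂ clauses of the line
    (hg : κ.IsTopGenerator (resGalOfEmb (closureEmb (K := ℚ) (v.adicCompletion ℚ)) g))
    (hc : ∀ n, c n ∈ localLayerPointsOfEmb κ (closureEmb (K := ℚ) (v.adicCompletion ℚ)) W n)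
    (hTr : ∀ n, 1 ≤ n → localTraceOfEmb κ (closureEmb (K := ℚ) (v.adicCompletion ℚ)) W n (n + 1)
      (c (n + 1)) = W.frobeniusTrace 2 • c n - c (n - 1))
    (hinj : ∀ z₀ : localLayerPointsOfEmb κ (closureEmb (K := ℚ) (v.adicCompletion ℚ)) W 0 →+ ℤ_[2],
      evalOn W (localLayerPointsOfEmb κ (closureEmb (K := ℚ) (v.adicCompletion ℚ)) W 0) z₀ (c 0) = 0 →
        z₀ = 0)
    (hsat : ∀ a : ℤ_[2],
      (∃ z₀ : localLayerPointsOfEmb κ (closureEmb (K := ℚ) (v.adicCompletion ℚ)) W 0 →+ ℤ_[2],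
        evalOn W (localLayerPointsOfEmb κ (closureEmb (K := ℚ) (v.adicCompletion ℚ)) W 0) z₀ (c 0) =
          2 * a) →
      ∃ y : localLayerPointsOfEmb κ (closureEmb (K := ℚ) (v.adicCompletion ℚ)) W 0 →+ ℤ_[2],
        evalOn W (localLayerPointsOfEmb κ (closureEmb (K := ℚ) (v.adicCompletion ℚ)) W 0) y (c 0) = a)
    -- by name: CASSELS and the three Poitou–Tate rows over `ℚ`
    (hC : Greenberg1999.casselsSurjectivity_H1Sigma ℚ) (hPT : poitouTate_sha_tateDual ℚ)
    (h3 : poitouTate_three_realPlaces_injective ℚ) (h2 : poitouTate_two_realPlaces_surjective ℚ) :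
    Finite (W.selmerGroupPInfty 2) →
      Finite (EndCoinvariants (conjSharpFlatSelmerInfty W κ (closureEmb (K := ℚ) (v.adicCompletion ℚ))
        (W.frobeniusTrace 2) g c .flat γ - 1)) →
      Nat.card (↥((sharpFlatSelmerInfty W κ (closureEmb (K := ℚ) (v.adicCompletion ℚ))
            (W.frobeniusTrace 2) g c .flat).comap (W.layerToInfty κ 0)) ⧸
          (W.selmerLayer κ 0).addSubgroupOf
            ((sharpFlatSelmerInfty W κ (closureEmb (K := ℚ) (v.adicCompletion ℚ))
              (W.frobeniusTrace 2) g c .flat).comap (W.layerToInfty κ 0))) *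
        Nat.card (MulAction.fixedPoints (Field.absoluteGaloisGroup ℚ) (W.geomPrimaryTorsion 2)) =
      2 ^ (padicValNat 2 W.tamagawaProduct) *
        Nat.card (EndCoinvariants (conjSharpFlatSelmerInfty W κ
          (closureEmb (K := ℚ) (v.adicCompletion ℚ)) (W.frobeniusTrace 2) g c .flat γ - 1)) :=
  flatCountTwo_of_cassels_of_poitouTate_of_clauses W hss κ hκ hγ hv hg hc hTr hinj hsat hC hPT h3 h2
    fun t ht w hw ↦ by
      -- AEU: a finite `S₀` outside which `t` is unramified (the binder of `hloc2_of_flatData`)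
      obtain ⟨S₀, -, htH⟩ := SignedEC.ResTwo.exists_finset_mem_unramifiedOutside W 2 κ.kerSubgroup t
      exact hloc2_of_flatData W hss κ hv hg hc hTr hinj S₀ t htH ht w hw

/-- **COUNT♭@2 from CASSELS and `Ш²(ℚ, E[2^∞]) = ⊥`, on the line's Honda₂ clauses; no displayed local input** — the
`Ш²`-keyed form of door v9 (`flatCountTwo_of_cassels_of_shaTwo` + GEN 10's derivation of the K3 shapes +
`hloc2_of_flatData`), for a consumer that supplies `Ш²(ℚ, E[2^∞]) = 0` by another road.
[cite: GreenbergLNM1716, §4 Prop. 4.13 / p. 122, Lemma 4.7 (pp. 107–108), Prop. 4.12 (p. 119)]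
[cite: Sprung2012, Thm. 2.2, Lemma 2.3, §7 Def. 7.9, Lemma 7.10] -/
theorem flatCountTwo_of_cassels_of_shaTwo_all (hss : GoodSS W 2) (κ : ZpExtension ℚ 2) (hκ : κ.IsCyclotomic)
    {γ : Field.absoluteGaloisGroup ℚ} (hγ : κ.IsTopGenerator γ) {v : HeightOneSpectrum (𝓞 ℚ)}
    (hv : (2 : 𝓞 ℚ) ∈ v.asIdeal)
    {g : Field.absoluteGaloisGroup (v.adicCompletion ℚ)} {c : ℕ → localPoints W (v.adicCompletion ℚ)}
    (hg : κ.IsTopGenerator (resGalOfEmb (closureEmb (K := ℚ) (v.adicCompletion ℚ)) g))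
    (hc : ∀ n, c n ∈ localLayerPointsOfEmb κ (closureEmb (K := ℚ) (v.adicCompletion ℚ)) W n)
    (hTr : ∀ n, 1 ≤ n → localTraceOfEmb κ (closureEmb (K := ℚ) (v.adicCompletion ℚ)) W n (n + 1)
      (c (n + 1)) = W.frobeniusTrace 2 • c n - c (n - 1))
    (hinj : ∀ z₀ : localLayerPointsOfEmb κ (closureEmb (K := ℚ) (v.adicCompletion ℚ)) W 0 →+ ℤ_[2],
      evalOn W (localLayerPointsOfEmb κ (closureEmb (K := ℚ) (v.adicCompletion ℚ)) W 0) z₀ (c 0) = 0 →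
        z₀ = 0)
    (hsat : ∀ a : ℤ_[2],
      (∃ z₀ : localLayerPointsOfEmb κ (closureEmb (K := ℚ) (v.adicCompletion ℚ)) W 0 →+ ℤ_[2],
        evalOn W (localLayerPointsOfEmb κ (closureEmb (K := ℚ) (v.adicCompletion ℚ)) W 0) z₀ (c 0) =
          2 * a) →
      ∃ y : localLayerPointsOfEmb κ (closureEmb (K := ℚ) (v.adicCompletion ℚ)) W 0 →+ ℤ_[2],
        evalOn W (localLayerPointsOfEmb κ (closureEmb (K := ℚ) (v.adicCompletion ℚ)) W 0) y (c 0) = a)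
    (hC : Greenberg1999.casselsSurjectivity_H1Sigma ℚ)
    (hsha : shaTwo (LocBridge.primaryGaloisModule W 2) = ⊥) :
    Finite (W.selmerGroupPInfty 2) →
      Finite (EndCoinvariants (conjSharpFlatSelmerInfty W κ (closureEmb (K := ℚ) (v.adicCompletion ℚ))
        (W.frobeniusTrace 2) g c .flat γ - 1)) →
      Nat.card (↥((sharpFlatSelmerInfty W κ (closureEmb (K := ℚ) (v.adicCompletion ℚ))
            (W.frobeniusTrace 2) g c .flat).comap (W.layerToInfty κ 0)) ⧸
          (W.selmerLayer κ 0).addSubgroupOf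
            ((sharpFlatSelmerInfty W κ (closureEmb (K := ℚ) (v.adicCompletion ℚ))
              (W.frobeniusTrace 2) g c .flat).comap (W.layerToInfty κ 0))) *
        Nat.card (MulAction.fixedPoints (Field.absoluteGaloisGroup ℚ) (W.geomPrimaryTorsion 2)) =
      2 ^ (padicValNat 2 W.tamagawaProduct) *
        Nat.card (EndCoinvariants (conjSharpFlatSelmerInfty W κ
          (closureEmb (K := ℚ) (v.adicCompletion ℚ)) (W.frobeniusTrace 2) g c .flat γ - 1)) := by
  -- Lemma 2.3 at `2` (tree theorem, GEN 10)
  have hnt : ∀ P ∈ localTowerPointsOfEmb κ (closureEmb (K := ℚ) (v.adicCompletion ℚ)) W, 2 • P = 0 → P = 0 :=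
    fun P hP hP2 ↦ eq_zero_of_mem_localTowerPointsOfEmb_of_two_nsmul W hss κ hv _ hP hP2
  refine flatCountTwo_of_cassels_of_shaTwo W hss κ hκ hγ hv g c (fun z hz x hx ↦ ?_) (fun y hy ↦ ?_) hC hsha
    fun t ht w hw ↦ ?_
  · exact apply_layer_zero_eq_zero_of_mem_colemanKer_flat (hc 0) hinj hz hx
  · exact mem_localKerOver_of_flat_rat W 2 κ hv hnt hss.2 hg hc hTr hinj hsat y hy
  · obtain ⟨S₀, -, htH⟩ := SignedEC.ResTwo.exists_finset_mem_unramifiedOutside W 2 κ.kerSubgroup t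
    exact hloc2_of_flatData W hss κ hv hg hc hTr hinj S₀ t htH ht w hw

/-- **DOOR v10 — COUNT♭@2 from the FOUR generic Poitou–Tate rows over `ℚ` and the Honda₂ clauses; nothing else.**
Door v9 with CASSELS (`Greenberg1999.casselsSurjectivity_H1Sigma ℚ`, Prop. 4.13) supplied from PT(b)
`poitouTate_selmerStructure_duality ℚ` by `SignedEC.CasselsPT.casselsSurjectivity_H1Sigma_of_poitouTate`.  Displayed
named facts: `poitouTate_selmerStructure_duality ℚ`, `poitouTate_sha_tateDual ℚ`, `poitouTate_three_realPlaces_injective ℚ`,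
`poitouTate_two_realPlaces_surjective ℚ` (Milne I 4.10 (b),(a),(c)₃, Cor. 4.16) — the same residue as crux K4
`SignedControlAtTwo`; zero Greenberg-1999 / Kato print, zero displayed local input.
[cite: GreenbergLNM1716, §4 Prop. 4.13 / p. 122, Prop. 4.12 (p. 119)] [cite: MilneADT2006, Ch. I, Thm. 4.10, Cor. 4.16, Lemma 6.15]
[cite: Cassels1964ArithmeticVII, Thm.] -/
theorem flatCountTwo_of_poitouTate_all (hss : GoodSS W 2) (κ : ZpExtension ℚ 2) (hκ : κ.IsCyclotomic)
    {γ : Field.absoluteGaloisGroup ℚ} (hγ : κ.IsTopGenerator γ) {v : HeightOneSpectrum (𝓞 ℚ)}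
    (hv : (2 : 𝓞 ℚ) ∈ v.asIdeal)
    {g : Field.absoluteGaloisGroup (v.adicCompletion ℚ)} {c : ℕ → localPoints W (v.adicCompletion ℚ)}
    (hg : κ.IsTopGenerator (resGalOfEmb (closureEmb (K := ℚ) (v.adicCompletion ℚ)) g))
    (hc : ∀ n, c n ∈ localLayerPointsOfEmb κ (closureEmb (K := ℚ) (v.adicCompletion ℚ)) W n)
    (hTr : ∀ n, 1 ≤ n → localTraceOfEmb κ (closureEmb (K := ℚ) (v.adicCompletion ℚ)) W n (n + 1)
      (c (n + 1)) = W.frobeniusTrace 2 • c n - c (n - 1))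
    (hinj : ∀ z₀ : localLayerPointsOfEmb κ (closureEmb (K := ℚ) (v.adicCompletion ℚ)) W 0 →+ ℤ_[2],
      evalOn W (localLayerPointsOfEmb κ (closureEmb (K := ℚ) (v.adicCompletion ℚ)) W 0) z₀ (c 0) = 0 →
        z₀ = 0)
    (hsat : ∀ a : ℤ_[2],
      (∃ z₀ : localLayerPointsOfEmb κ (closureEmb (K := ℚ) (v.adicCompletion ℚ)) W 0 →+ ℤ_[2],
        evalOn W (localLayerPointsOfEmb κ (closureEmb (K := ℚ) (v.adicCompletion ℚ)) W 0) z₀ (c 0) =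
          2 * a) →
      ∃ y : localLayerPointsOfEmb κ (closureEmb (K := ℚ) (v.adicCompletion ℚ)) W 0 →+ ℤ_[2],
        evalOn W (localLayerPointsOfEmb κ (closureEmb (K := ℚ) (v.adicCompletion ℚ)) W 0) y (c 0) = a)
    -- by name: the four Poitou–Tate rows over `ℚ`
    (hPTb : poitouTate_selmerStructure_duality ℚ) (hPT : poitouTate_sha_tateDual ℚ)
    (h3 : poitouTate_three_realPlaces_injective ℚ) (h2 : poitouTate_two_realPlaces_surjective ℚ) :
    Finite (W.selmerGroupPInfty 2) →
      Finite (EndCoinvariants (conjSharpFlatSelmerInfty W κ (closureEmb (K := ℚ) (v.adicCompletion ℚ))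
        (W.frobeniusTrace 2) g c .flat γ - 1)) →
      Nat.card (↥((sharpFlatSelmerInfty W κ (closureEmb (K := ℚ) (v.adicCompletion ℚ))
            (W.frobeniusTrace 2) g c .flat).comap (W.layerToInfty κ 0)) ⧸
          (W.selmerLayer κ 0).addSubgroupOf
            ((sharpFlatSelmerInfty W κ (closureEmb (K := ℚ) (v.adicCompletion ℚ))
              (W.frobeniusTrace 2) g c .flat).comap (W.layerToInfty κ 0))) *
        Nat.card (MulAction.fixedPoints (Field.absoluteGaloisGroup ℚ) (W.geomPrimaryTorsion 2)) =
      2 ^ (padicValNat 2 W.tamagawaProduct) *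
        Nat.card (EndCoinvariants (conjSharpFlatSelmerInfty W κ
          (closureEmb (K := ℚ) (v.adicCompletion ℚ)) (W.frobeniusTrace 2) g c .flat γ - 1)) :=
  flatCountTwo_of_cassels_of_poitouTate_all W hss κ hκ hγ hv hg hc hTr hinj hsat
    (SignedEC.CasselsPT.casselsSurjectivity_H1Sigma_of_poitouTate hPTb) hPT h3 h2

end Summit.BirchSwinnertonDyer.BirchSwinnertonDyer.Theorems.SSFlatEC

end
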